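import Summits.NavierStokesRegularity.NavierStokesRegularity.Theorems.ExtremiserTransiencePinnedDepletionDefs
import Summits.NavierStokesRegularity.NavierStokesRegularity.Theorems.ExtremiserTransienceNearExtremalTransiencePerFlowStubEfficiencyContinuous
import Summits.NavierStokesRegularity.NavierStokesRegularity.Theorems.ExtremiserTransienceNearExtremalTransienceDSSPerFlowAnalytic
import Summits.NavierStokesRegularity.NavierStokesRegularity.Theorems.ExtremiserTransienceNearExtremalTransienceThetaOne
import HarnessLib

/-!
# Crux `NearExtremalTransiencePerFlow` (stmt-NavierStokesRegularity-26567), LINE g13-β `relay`: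
# the heart D♭ `CellRelayDecomposition` ALSO reduces to LATE windows

Theorems file (`--supports stmt-NavierStokesRegularity-26567`, helper; prover seat ns-net-p1 g17), companion of
`…PinnedDepletionLateWindows` (where the junction `C′`, K♭ and C♭ are reduced to late windows).  Texts of record
`…Theorems.ExtremiserTransiencePinnedDepletionDefs`.

* `exists_uniform_coeff_bound_on_compact` — in a violator, a MINIMAL coefficient `k₀` (`IsMinimalCoeff`) stays uniformly below `κ⋆`
  on every compact interval of positive times: `k₀ ≤ κ⋆ − ε₀` on `[s₁, s₂] ⊂ (0,T)` for one `ε₀ ∈ (0, κ⋆]` (Z3 `stub_efficiencyContinuous`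
  p661994 + `DepletionLadder.minimalCoeff_lt_sharp_of_pos` + compactness).
* `CellRelayDecomposition.of_late` — D♭ follows from its LATE version (onset `t₁ < T` chosen per violator and window package BEFORE
  `δ₀, η, Λ`; families owed only on pinned windows with `t₁ ≤ t`).  EARLY windows (`t ≤ t₁`) are served by ONE cell (`w₀ ≡ 1`,
  `q₀ = k₀`, domination = the flow-wise clause, `q₀ ≤ κ⋆` = minimality against universality): under the pin `|I| = a(T−t)`,
  `a = τ₁/C²`, the part `[t + η'|I|, t + |I|]` of every early window lies in the fixed compact `[η'a(T−t₁), t₁ + a(T−t₁)] ⊂ (0,T)` where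
  `k₀ ≤ κ⋆ − ε₀`, so with the margin `δ₀' = min(δ₀, ε₀/2)` the cell is efficient only on the initial `η'`-fraction; the constants are
  made uniform by `η' = max(η, 1/(4Λ)) > 0` (still `2Λη' < 1`) and `δ₀' ≤ δ₀` (monotonicity of the late families' transience clause).

With `…PinnedDepletionLateWindows`: ALL FOUR pinned statements of the g13 lines (C′, K♭, C♭, D♭) are statements about windows
arbitrarily close to the blow-up time.  HONEST FRAMING: statements about hypothetical Type-I singular flows violating the crux; D♭,
the junction, ⟨26567⟩ and NS regularity are OPEN; nothing about Navier–Stokes regularity or blow-up is proved; no summit is proved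
by a line. [folklore]
-/

noncomputable section

open scoped Topology InnerProductSpace RealInnerProductSpace ENNReal ContDiff
open MeasureTheory Filter Set Metric
open Literature.Analysis.FluidPDE
open Summit.NavierStokesRegularity.NavierStokesRegularity.Theorems
open Summit.NavierStokesRegularity.NavierStokesRegularity.Theorems.DepletionLadder.KStar.HalfSpace
open Summit.NavierStokesRegularity.NavierStokesRegularity.Theorems.NearExtremalTransiencePerFlow.ZoneTransversality

namespace Summit.NavierStokesRegularity.NavierStokesRegularity.Theorems.NearExtremalTransiencePerFlow.PinnedDepletion

-- the summit's namespace repeats the problem name by convention (D-0017)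
set_option linter.dupNamespace false

/-! ### §1 A minimal coefficient stays uniformly below `κ⋆` on compact intervals of positive times -/

/-- **Uniform coefficient bound away from `0` and `T`.**  In a violator flow, a minimal coefficient `k₀` satisfies
`k₀ ≤ κ⋆ − ε₀` on every compact `[s₁, s₂] ⊂ (0,T)`, for one `0 < ε₀ ≤ κ⋆`. [folklore] -/
theorem exists_uniform_coeff_bound_on_compact {C ν T : ℝ} {u : ℝ → EuclideanSpace ℝ (Fin 3) → EuclideanSpace ℝ (Fin 3)}
    {p : ℝ → EuclideanSpace ℝ (Fin 3) → ℝ} (hV : IsViolator C ν T u p) {k₀ : ℝ → ℝ} (hk₀ : IsMinimalCoeff T u k₀)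
    {s₁ s₂ : ℝ} (hs₁ : 0 < s₁) (hs₁₂ : s₁ ≤ s₂) (hs₂ : s₂ < T) :
    ∃ ε₀ : ℝ, 0 < ε₀ ∧ ε₀ ≤ kStar ∧ ∀ t' ∈ Set.Icc s₁ s₂, k₀ t' ≤ kStar - ε₀ := by
  have hV' := hV
  obtain ⟨hC, hν, hT, hsol, hLH, hdec, hrate, hsing, hno⟩ := hV
  have hcont : ContinuousOn k₀ (Set.Ioo 0 T) := stub_efficiencyContinuous C ν T u p hV' k₀ hk₀
  obtain ⟨hkm, hk01, hcl, hmin⟩ := hk₀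
  have hsub : Set.Icc s₁ s₂ ⊆ Set.Ioo 0 T := fun t ht => ⟨hs₁.trans_le ht.1, lt_of_le_of_lt ht.2 hs₂⟩
  have hcpt : IsCompact (Set.Icc s₁ s₂) := isCompact_Icc
  have hne : (Set.Icc s₁ s₂).Nonempty := ⟨s₁, le_rfl, hs₁₂⟩
  obtain ⟨tm, htm, hmax⟩ := hcpt.exists_isMaxOn hne (hcont.mono hsub)
  have hlt : k₀ tm < kStar := by
    unfold kStar udcSet
    exact DepletionLadder.minimalCoeff_lt_sharp_of_pos hν hT hsol hLH hdec hmin tm (hsub htm)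
  refine ⟨kStar - k₀ tm, sub_pos.2 hlt, by linarith [(hk01 tm).1], ?_⟩
  intro t' ht'
  have := hmax ht'
  simp only [Set.mem_setOf_eq] at this
  linarith

/-! ### §2 D♭ reduces to late windows -/

set_option maxHeartbeats 400000 in
/-- **D♭ reduces to late windows.**  If every violator has, for every window package `(Θ, G, H, τ₁)`, an onset `t₁ < T` and constants
`δ₀ ∈ (0, κ⋆]`, `η ≥ 0`, `Λ ≥ 1`, `2Λη < 1` such that every PINNED admissible window with `t₁ ≤ t` carries the D♭ families, then
`CellRelayDecomposition` (early windows: one cell on the minimal coefficient, efficient only on the initial `η'`-fraction by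
`exists_uniform_coeff_bound_on_compact`; constants `δ₀' = min(δ₀, ε₀/2)`, `η' = max(η, 1/(4Λ))`, `Λ`). [folklore] -/
theorem CellRelayDecomposition.of_late
    (h : ∀ (C ν T : ℝ) (u : ℝ → EuclideanSpace ℝ (Fin 3) → EuclideanSpace ℝ (Fin 3)) (p : ℝ → EuclideanSpace ℝ (Fin 3) → ℝ),
      IsViolator C ν T u p →
      ∀ (Θ G H τ₁ : ℝ), 0 < Θ → 0 < G → 0 < H → 0 < τ₁ → ∃ t₁ : ℝ, t₁ < T ∧
      ∃ δ₀ η Λ : ℝ, 0 < δ₀ ∧ δ₀ ≤ kStar ∧ 0 ≤ η ∧ 1 ≤ Λ ∧ 2 * Λ * η < 1 ∧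
      ∀ (t M : ℝ), 0 ≤ t → 0 < M → t + τ₁ * ν / M ^ 2 < T → M = C * Real.sqrt ν / Real.sqrt (T - t) → t₁ ≤ t →
        (∀ x, ‖u t x‖ ≤ M) →
        (∫ x, ‖curl (u t) x‖ ^ 2) ≤ Θ * (ν / M) ^ 2 * (∫ x, frobeniusNormSq (fderiv ℝ (curl (u t)) x)) →
        (∀ x, ‖fderiv ℝ (u t) x‖ ≤ G * M ^ 2 / ν) →
        (∀ t' ∈ Set.Icc t (t + τ₁ * ν / M ^ 2), ∀ x, ‖u t' x‖ ≤ H * M) →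
        ∃ (w q : ℕ → ℝ → ℝ),
          (∀ i, Measurable (w i)) ∧ (∀ i, Measurable (q i)) ∧
          (∀ i t', 0 ≤ w i t') ∧
          (∀ t' ∈ Set.Icc t (t + τ₁ * ν / M ^ 2), Summable (fun i => w i t') ∧ ∑' i, w i t' ≤ 1) ∧
          (∀ i, ∀ t' ∈ Set.Icc t (t + τ₁ * ν / M ^ 2), q i t' ≤ kStar) ∧
          (∀ i, ∀ t' ∈ Set.Icc t (t + τ₁ * ν / M ^ 2), w i t' ≤ Λ * w i t) ∧
          (∀ i, volume ({t' : ℝ | kStar - δ₀ < q i t'} ∩ Set.Icc t (t + τ₁ * ν / M ^ 2)) ≤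
            ENNReal.ofReal (η * (τ₁ * ν / M ^ 2))) ∧
          (∀ t' ∈ Set.Icc t (t + τ₁ * ν / M ^ 2), ∀ M' : ℝ, (∀ x, ‖u t' x‖ ≤ M') →
            |∫ x, ⟪curl (u t') x, fderiv ℝ (u t') x (curl (u t') x)⟫_ℝ| ≤
              (∑' i, w i t' * q i t') * M' * Real.sqrt (∫ x, ‖curl (u t') x‖ ^ 2) *
                Real.sqrt (∫ x, frobeniusNormSq (fderiv ℝ (curl (u t')) x)))) :
    CellRelayDecomposition := by
  intro C ν T u p hV Θ G H τ₁ hΘ hG hH hτ₁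
  have hV' := hV
  obtain ⟨hC, hν, hT, hsol, hLH, hdec, hrate, hsing, hno⟩ := hV
  obtain ⟨t₁, ht₁, δ₀, η, Λ, hδ₀, hδ₀κ, hη, hΛ, hΛη, hlate⟩ := h C ν T u p hV' Θ G H τ₁ hΘ hG hH hτ₁
  have hK : 0 < kStar := kStar_pos
  have hC2 : 0 < C ^ 2 := by positivity
  have hΛ0 : 0 < Λ := by linarith
  -- a minimal coefficient of THIS flow: measurable, flow-wise clause (domination), `k₀ ≤ κ⋆` by minimality against universality
  obtain ⟨k₀, hk₀⟩ := exists_isMinimalCoeff hν hT hsol hLH hdec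
  have hk₀' := hk₀
  obtain ⟨hkm, hk01, hcl, hmin⟩ := hk₀
  have huniv := DepletionLadder.flowwise_of_universal DepletionLadder.sharpDepletion_is_universal hν hT hsol hLH hdec
  have hkle : ∀ t' ∈ Set.Ico 0 T, k₀ t' ≤ kStar := by
    intro t' ht'
    refine hmin t' ht' kStar hK.le ?_
    unfold kStar udcSet
    exact huniv t' ht'
  -- the new constants `η' = max η (1/(4Λ)) > 0`, still `2Λη' < 1`
  set η' : ℝ := max η (1 / (4 * Λ)) with hη'def
  have hη'pos : 0 < η' := lt_of_lt_of_le (by positivity) (le_max_right _ _)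
  have hηη' : η ≤ η' := le_max_left _ _
  have h2Λη' : 2 * Λ * η' < 1 := by
    have h2Λ : 0 ≤ 2 * Λ := by positivity
    rcases le_total η (1 / (4 * Λ)) with hle | hle
    · rw [hη'def, max_eq_right hle]
      rw [show 2 * Λ * (1 / (4 * Λ)) = 1 / 2 by field_simp; ring]
      norm_num
    · rw [hη'def, max_eq_left hle]
      exact hΛη
  have hη'1 : η' < 1 := by nlinarith
  -- the relative window length `a = τ₁/C²` and the window identity under the pin
  set a : ℝ := τ₁ / C ^ 2 with hadef
  have ha : 0 < a := div_pos hτ₁ hC2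
  have hwin : ∀ t M : ℝ, t < T → M = C * Real.sqrt ν / Real.sqrt (T - t) → τ₁ * ν / M ^ 2 = a * (T - t) := by
    intro t M htT hpin
    have hTt : 0 < T - t := sub_pos.2 htT
    have hM2 : M ^ 2 = C ^ 2 * ν / (T - t) := by
      rw [hpin, div_pow, mul_pow, Real.sq_sqrt hν.le, Real.sq_sqrt hTt.le]
    rw [hM2, hadef]
    field_simp
  -- the uniform coefficient bound on the compact serving the early windows (only needed when `0 ≤ t₁` and `a < 1`)
  obtain ⟨ε₀, hε₀, hε₀κ, hbound⟩ : ∃ ε₀ : ℝ, 0 < ε₀ ∧ ε₀ ≤ kStar ∧ (0 ≤ t₁ → a < 1 →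
      ∀ t' ∈ Set.Icc (η' * a * (T - t₁)) (t₁ + a * (T - t₁)), k₀ t' ≤ kStar - ε₀) := by
    by_cases ht₁0 : 0 ≤ t₁
    · by_cases ha1 : a < 1
      · have hTt₁ : 0 < T - t₁ := sub_pos.2 ht₁
        have hs₁ : 0 < η' * a * (T - t₁) := by positivity
        have hs₂ : t₁ + a * (T - t₁) < T := by nlinarith
        have hs₁₂ : η' * a * (T - t₁) ≤ t₁ + a * (T - t₁) := by nlinarith [mul_pos ha hTt₁]
        obtain ⟨ε₀, hε₀, hε₀κ, hb⟩ := exists_uniform_coeff_bound_on_compact hV' hk₀' hs₁ hs₁₂ hs₂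
        exact ⟨ε₀, hε₀, hε₀κ, fun _ _ => hb⟩
      · exact ⟨kStar, hK, le_rfl, fun _ h' => absurd h' ha1⟩
    · exact ⟨kStar, hK, le_rfl, fun h' _ => absurd h' ht₁0⟩
  -- the uniform constants
  set δ₀' : ℝ := min δ₀ (ε₀ / 2) with hδ₀'def
  have hδ₀' : 0 < δ₀' := lt_min hδ₀ (by linarith)
  have hδ₀'δ₀ : δ₀' ≤ δ₀ := min_le_left _ _
  have hδ₀'ε₀ : δ₀' ≤ ε₀ / 2 := min_le_right _ _
  have hδ₀'κ : δ₀' ≤ kStar := hδ₀'δ₀.trans hδ₀κ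
  refine ⟨δ₀', η', Λ, hδ₀', hδ₀'κ, hη'pos.le, hΛ, h2Λη', ?_⟩
  intro t M ht hM htT hpin hMb hlock hgrad hheights
  have hL : 0 < τ₁ * ν / M ^ 2 := by positivity
  have htT' : t < T := by linarith
  have hIT : ∀ t' ∈ Set.Icc t (t + τ₁ * ν / M ^ 2), t' ∈ Set.Ico 0 T :=
    fun t' ht' => ⟨ht.trans ht'.1, lt_of_le_of_lt ht'.2 htT⟩
  rcases le_total t₁ t with hlt | het
  · -- LATE window: the given families, transience clause weakened monotonically (`δ₀' ≤ δ₀`, `η ≤ η'`)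
    obtain ⟨w, q, hwm, hqm, hw0, hsum, hqle, hpers, htrans, hdom⟩ :=
      hlate t M ht hM htT hpin hlt hMb hlock hgrad hheights
    refine ⟨w, q, hwm, hqm, hw0, hsum, hqle, hpers, fun i => ?_, hdom⟩
    have hsub : ({t' : ℝ | kStar - δ₀' < q i t'} ∩ Set.Icc t (t + τ₁ * ν / M ^ 2)) ⊆
        ({t' : ℝ | kStar - δ₀ < q i t'} ∩ Set.Icc t (t + τ₁ * ν / M ^ 2)) := by
      rintro t' ⟨h1, h2⟩
      have h1' : kStar - δ₀' < q i t' := h1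
      refine ⟨?_, h2⟩
      show kStar - δ₀ < q i t'
      linarith
    refine (measure_mono hsub).trans ((htrans i).trans (ENNReal.ofReal_le_ofReal ?_))
    exact mul_le_mul_of_nonneg_right hηη' hL.le
  · -- EARLY window: one cell on the minimal coefficient
    have ht₁0 : 0 ≤ t₁ := ht.trans het
    have hLeq : τ₁ * ν / M ^ 2 = a * (T - t) := hwin t M htT' hpin
    have hTt : 0 < T - t := sub_pos.2 htT'
    have ha1 : a < 1 := by
      by_contra hge
      push Not at hge
      have : T - t ≤ a * (T - t) := by nlinarith
      linarith
    have hb := hbound ht₁0 ha1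
    set L : ℝ := τ₁ * ν / M ^ 2 with hLdef
    refine ⟨fun i _ => if i = 0 then (1 : ℝ) else 0, fun i t' => if i = 0 then k₀ t' else 0,
      fun i => measurable_const, fun i => ?_, fun i t' => ?_, fun t' _ => ?_, fun i t' ht' => ?_, fun i t' _ => ?_,
      fun i => ?_, fun t' ht' M' hM' => ?_⟩
    · -- measurability of the quotients
      by_cases hi : i = 0
      · simp only [hi, if_true]; exact hkm
      · simp only [hi, if_false]; exact measurable_const
    · -- weights are non-negative
      by_cases hi : i = 0
      · simp only [hi, if_true]; exact zero_le_one
      · simp only [hi, if_false]; exact le_rfl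
    · -- total weight `= 1 ≤ 1`
      refine ⟨(hasSum_ite_eq 0 (1 : ℝ)).summable, ?_⟩
      rw [tsum_ite_eq]
    · -- quotients `≤ κ⋆`
      by_cases hi : i = 0
      · simp only [hi, if_true]; exact hkle t' (hIT t' ht')
      · simp only [hi, if_false]; exact hK.le
    · -- persistence (constant weights, `Λ ≥ 1`)
      by_cases hi : i = 0
      · simp only [hi, if_true]; linarith
      · simp only [hi, if_false, mul_zero]; exact le_rfl
    · -- individual transience: cell `0` is efficient only on the initial `η'`-fraction of the window
      by_cases hi : i = 0
      · simp only [hi, if_true]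
        have hsub : ({t' : ℝ | kStar - δ₀' < k₀ t'} ∩ Set.Icc t (t + L)) ⊆ Set.Ico t (t + η' * L) := by
          rintro t' ⟨hkt', ht'I⟩
          have hkt'' : kStar - δ₀' < k₀ t' := hkt'
          refine ⟨ht'I.1, ?_⟩
          by_contra hge
          push Not at hge
          -- then `t'` lies in the compact where `k₀ ≤ κ⋆ − ε₀ ≤ κ⋆ − δ₀'`
          have hlo : η' * a * (T - t₁) ≤ t' := by
            have : η' * a * (T - t₁) ≤ t + η' * (a * (T - t)) := by nlinarith [mul_pos hη'pos ha]
            rw [hLeq] at hge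
            linarith
          have hhi : t' ≤ t₁ + a * (T - t₁) := by
            have h2 : t' ≤ t + a * (T - t) := by rw [← hLeq]; exact ht'I.2
            nlinarith
          have hk := hb t' ⟨hlo, hhi⟩
          linarith
        calc volume ({t' : ℝ | kStar - δ₀' < k₀ t'} ∩ Set.Icc t (t + L))
            ≤ volume (Set.Ico t (t + η' * L)) := measure_mono hsub
          _ = ENNReal.ofReal (η' * L) := by rw [Real.volume_Ico]; ring_nf
      · simp only [hi, if_false]
        have hempty : ({t' : ℝ | kStar - δ₀' < 0} ∩ Set.Icc t (t + L)) = ∅ := by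
          ext t'
          simp only [Set.mem_inter_iff, Set.mem_setOf_eq, Set.mem_empty_iff_false, iff_false, not_and]
          intro hlt'
          exact absurd hlt' (by linarith)
        rw [hempty, measure_empty]
        exact bot_le
    · -- domination: `Σ' wᵢqᵢ = k₀(t')` and the flow-wise clause
      have hsum : ∑' i : ℕ, (if i = 0 then (1 : ℝ) else 0) * (if i = 0 then k₀ t' else 0) = k₀ t' := by
        have hterm : ∀ i : ℕ, (if i = 0 then (1 : ℝ) else 0) * (if i = 0 then k₀ t' else 0) =
            if i = 0 then k₀ t' else 0 := by
          intro i
          by_cases hi : i = 0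
          · simp only [hi, if_true, one_mul]
          · simp only [hi, if_false, zero_mul]
        rw [tsum_congr hterm, tsum_ite_eq]
      rw [hsum]
      exact hcl t' (hIT t' ht') M' hM'

end Summit.NavierStokesRegularity.NavierStokesRegularity.Theorems.NearExtremalTransiencePerFlow.PinnedDepletion

end
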